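import Summits.AtomisticToContinuum.FouriersLaw.Theses.EmbeddedDrudeMourre
import Literature.MathematicalPhysics.KineticTheory.InfiniteChainSuperstableDynamics
import Literature.MathematicalPhysics.KineticTheory.InfiniteChainSuperstableEstimates
import Literature.MathematicalPhysics.KineticTheory.InfiniteChainInvariantStates
import Literature.MathematicalPhysics.KineticTheory.InfiniteChainCurrentMoments
import Literature.MathematicalPhysics.KineticTheory.InfiniteChainEnergyDensityMoments
import Literature.MathematicalPhysics.KineticTheory.InfiniteChainGibbsExistenceShift

/-!
# The witness-regularisation seam of line `loomis-compact-horizon-witness`, reduced to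
# DYNAMICAL TIGHTNESS + DLR UNIQUENESS IN THE TIGHT CLASS
(crux `EmbeddedDrudeMourre.AbelThermodynamicLimit`, item stmt-AtomisticToContinuum-12596;
`--supports` helper file, closes nothing; proves the registered reduction stub
`stub_witnessRegularisationOfDynamicalTightness`)

The registered seam `stub_witnessRegularisation` (shared with the sibling crux
`GreenKuboContinuation`): for `P = pinnedChain ω₂ lam β γ` (all `> 0`) and `T > 0`, IF some Abelian
Green–Kubo witness `(μT, D', κ)` exists at `T` — ANY DLR state `μT`, ANY `μT`-preserving
`InfiniteChainDynamics D'` with absolutely convergent current correlations, `κ > 0` the Abel limit of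
`T⁻² ∫₀^∞ e^{-νt} C_{D',μT}(t) dt` — THEN a witness whose STATE is regular (DLR + shift-invariant +
Buttà–Marchioro superstable) exists at `T`.

## What is proved here (all proofs complete)

* §1 `measure_abs_fst_gt_le_of_hasSuperstabilityEstimate`, `oneSiteTight_of_hasSuperstabilityEstimate`:
  a BM-superstable state of the pinned chain (`ω₂ > 0`) has one-site position marginals with a
  UNIFORM Gaussian tail, `μ {R < |q_x|} ≤ e^{C - λ₀ ω₂ R²/2}` for all `x` (BM (2.3) with `k = 0`,
  `W_{x,0} ≥ U(q_x) ≥ ω₂ q_x²/2`, Chebyshev), hence is ONE-SITE TIGHT: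
  `∀ ε > 0 ∃ R ∀ x, μ {R < |q_x|} ≤ ε`.
* §2 `stub_witnessRegularisationOfDynamicalTightness` (registered on the crux item): the seam
  follows from the conjunction of
  (DT) DYNAMICAL TIGHTNESS at `T`: every DLR state of `P` at `T` that is preserved by SOME
       `InfiniteChainDynamics` with absolutely convergent current correlations is one-site tight;
  (TU) TIGHT UNIQUENESS at `T`: two one-site-tight DLR states of `P` at `T` coincide.
  Proof: the tree now HAS a regular state `μ_reg` at every `T > 0`
  (`OscillatorChain.exists_isChainGibbsMeasure_shiftInvariant_superstable_pinnedChain`, the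
  transfer-operator / Markov-chain construction); `μ_reg` is tight by §1, the witness state `μT` is
  tight by (DT), so `μT = μ_reg` by (TU) and `(μT, D', κ)` itself is the regular witness — the
  dynamics is untouched.

## Why this is the right split (diagnosis of the worker, 2026-08-16)

* (TU) is printed-level and TRUE: under any DLR state the momenta are i.i.d. `N(0,T)` independent of
  the positions (LLL 1977 §4 (ii); tree: `map_snd_eq_gaussianReal`), and the positions form the 1-D
  nearest-neighbour unbounded-spin chain with strictly positive symmetric Hilbert–Schmidt transfer
  kernel `Q(a,b) = e^{-U(a)/2T} e^{-V(b-a)/T} e^{-U(b)/2T}`; a DLR state is `∫ γ_{[-n,n]}(· | η) dμ(η)`,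
  the kernel `γ_{[-n,n]}(· | a, b)` is the bridge of the ground-state-transformed chain `P̃` from `a`
  to `b`, and the `L²(h² dx)` spectral gap of the compact positivity-improving `P̃` makes the window
  marginals of the bridge converge to those of `μ_reg` UNIFORMLY over `|a|, |b| ≤ R`; tightness
  supplies `μ(|q_{±(n+1)}| > R) ≤ ε`. (Cassandro–Olivieri–Pellegrinotti–Presutti 1978 §2; Georgii
  2011 Thm 10.25, §11.1.) (TU) implies the line's `stub_regularDLRUnique` (S7) by §1, so ONE
  uniqueness stub can serve both S4 and S6. Size: the transfer-operator project (≈ 2–3 kLoC on top of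
  `InfiniteChainGibbsExistence*` / `MarkovChainMeasure`).
* (DT) is the irreducible open content of the seam ("R1" of the sibling's wave-2 analysis, sharpened
  from "regular" to "one-site tight", which is strictly weaker than BM (2.3) and than shift
  invariance). It does NOT follow from DLR alone: by a paper-level construction (not formalised
  here) the pinned quartic chain has NON-TIGHT ("stretched") DLR states — Doob transforms of the
  stationary `P̃`-chain by a non-constant positive space-time harmonic sequence `u_b = P̃ u_{b+1}`,
  obtained as the Martin limit along `y_N = Y₀ c^{-N}` (`c = c(lam, β) ∈ (0,1)` the asymptotic
  backward contraction ratio of the bridge from a far point: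
  `q_b ≈ c q_{b+1}` with relative fluctuations `O(√T q_{b+1}^{-2})`, summable along a geometric
  profile, so the limit exists and is non-degenerate); their position profile grows like `Y₀ c^{-x}`
  as `x → +∞` (the nonlinear analogue of the Gaussian states of the harmonic pinned chain centred at
  solutions `A λ^x + B λ^{-x}` of `(-Δ + ω₂) m = 0`). Whether a stretched DLR state can carry a
  measure-preserving `InfiniteChainDynamics` with absolutely convergent current correlations is OPEN
  and not in print. The only obstruction mechanism found uses `β > 0`: along a stretched profile the
  spring stiffness `V''(q_{x+1}-q_x) ~ 3β Y₀² c^{-2x}` grows geometrically, so the acoustic travel time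
  from `+∞` to the origin `Σ_x V''^{-1/2} < ∞` is FINITE (influx from infinity in finite time: the
  Lanford–Lebowitz–Lieb / Dobrushin–Fritz / Buttà–Marchioro uniqueness iterations all diverge on such
  configurations, and the light-cone bounds behind absolutely convergent correlations are
  unavailable); for `β = 0 < lam`
  the stiffness is bounded and stretched states very plausibly DO carry a preserving dynamics (as the
  shifted Gaussian states of the harmonic chain do: the profile is an exact equilibrium
  configuration), so any proof of (DT) must use `β > 0`.
* Cesàro regularisation of the STATE (averaging translates) does not help: the witness predicate is
  anchored at bond `0`, the translate `(τ_k)_* μT` with the conjugated dynamics has Abel functional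
  anchored at bond `k`, on which the hypothesis is silent; and Abel limits are not closed under local
  convergence of states without an equi-modulus (`abelLimit_not_weakly_closed`, tree).
* `HasAbsConvergentCorrelation` at `t = 0` is automatic for EVERY DLR state (`⟨j_0 j_x⟩ = 0` for
  `|x| ≥ 2`: momenta i.i.d. centred, independent of positions), so the correlation clause carries no
  static information; BM (2.3) is a uniform-in-centre static bound violated by stretched states.
* Recommended resolution (planner level, not a stub matter): quantify the crux's witness clause over
  REGULAR states (`IsShiftInvariant μT ∧ HasSuperstabilityEstimate μT`), after which the seam is the
  identity and `regularWitness_of_regularState_of_aeOrbits` (tree) handles the dynamics half.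
-/

noncomputable section

namespace Summit.AtomisticToContinuum.FouriersLaw.Theorems.AbelThermodynamicLimit.LoomisCompactHorizonWitness

open MeasureTheory Filter Set
open scoped ENNReal
open Literature.MathematicalPhysics.KineticTheory.HeatConduction

/-! ## §1 Superstable states of the pinned chain are one-site tight -/

/-- **Uniform Gaussian tail of the one-site position marginals of a superstable state.** For the
pinned chain (`ω₂, lam, β ≥ 0`) and a state `μ` with BM's superstability estimate (2.3) (constants
`C, λ₀`): `μ {R < |q_x|} ≤ e^{C - λ₀ ω₂ R²/2}` for every site `x` and every `R ≥ 0`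
(BM (2.3) at `k = 0`, `W_{x,0} ≥ U(q_x) ≥ ω₂ q_x²/2`, Chebyshev). [folklore] -/
theorem measure_abs_fst_gt_le_of_hasSuperstabilityEstimate {ω₂ lam β : ℝ} (γ : ℝ)
    (hω : 0 ≤ ω₂) (hl : 0 ≤ lam) (hβ : 0 ≤ β) {μ : Measure ChainConfig}
    (hss : (pinnedChain ω₂ lam β γ).HasSuperstabilityEstimate μ) :
    ∃ C lam₀ : ℝ, 0 < lam₀ ∧ ∀ R : ℝ, 0 ≤ R → ∀ x : ℤ,
      μ {σ : ChainConfig | R < |(σ x).1|} ≤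
        ENNReal.ofReal (Real.exp (C - lam₀ * (ω₂ * R ^ 2 / 2))) := by
  obtain ⟨-, C, lam₀, -, hlam₀, hbound⟩ := hss
  refine ⟨C, lam₀, hlam₀, fun R hR x => ?_⟩
  have hW := hbound lam₀ hlam₀ le_rfl x 0
  simp only [Nat.cast_zero, mul_zero, zero_add, mul_one] at hW
  set A : Set ChainConfig := {σ : ChainConfig | R < |(σ x).1|} with hAdef
  have hA : MeasurableSet A :=
    measurableSet_lt measurable_const
      (continuous_abs.measurable.comp (measurable_pi_apply x).fst)
  set c : ℝ≥0∞ := ENNReal.ofReal (Real.exp (lam₀ * (ω₂ * R ^ 2 / 2))) with hcdef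
  have hle : ∀ σ ∈ A, c ≤ ENNReal.ofReal
      (Real.exp (lam₀ * (pinnedChain ω₂ lam β γ).bmLocalEnergy x 0 σ)) := by
    intro σ hσ
    apply ENNReal.ofReal_le_ofReal
    apply Real.exp_le_exp.mpr
    apply mul_le_mul_of_nonneg_left _ hlam₀.le
    have h1 := OscillatorChain.site_le_bmLocalEnergy (P := pinnedChain ω₂ lam β γ)
      (OscillatorChain.pinnedChain_U_nonneg β γ hω hl) (OscillatorChain.pinnedChain_V_nonneg ω₂ lam γ hβ)
      (μ := x) (k := 0) σ (OscillatorChain.mem_cbox_self x 0)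
    have hσ' : R < |(σ x).1| := hσ
    have hRabs : |R| ≤ |(σ x).1| := by rw [abs_of_nonneg hR]; exact hσ'.le
    have hR2 : R ^ 2 ≤ ((σ x).1) ^ 2 := sq_le_sq.mpr hRabs
    have h2 : ω₂ * R ^ 2 / 2 ≤ (pinnedChain ω₂ lam β γ).U (σ x).1 := by
      show ω₂ * R ^ 2 / 2 ≤ ω₂ * ((σ x).1) ^ 2 / 2 + lam * ((σ x).1) ^ 4 / 4
      have h4 : 0 ≤ lam * ((σ x).1) ^ 4 / 4 := by positivity
      nlinarith [mul_le_mul_of_nonneg_left hR2 hω]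
    nlinarith [sq_nonneg ((σ x).2)]
  have hmain : c * μ A ≤ ENNReal.ofReal (Real.exp C) := by
    calc c * μ A = ∫⁻ σ, A.indicator (fun _ => c) σ ∂μ := (lintegral_indicator_const hA c).symm
      _ ≤ ∫⁻ σ, ENNReal.ofReal
            (Real.exp (lam₀ * (pinnedChain ω₂ lam β γ).bmLocalEnergy x 0 σ)) ∂μ := by
          refine lintegral_mono fun σ => ?_
          by_cases hσ : σ ∈ A
          · rw [indicator_of_mem hσ]; exact hle σ hσ
          · rw [indicator_of_notMem hσ]; exact bot_le
      _ ≤ ENNReal.ofReal (Real.exp C) := hW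
  have hc0 : c ≠ 0 := by
    rw [hcdef]; exact ENNReal.ofReal_ne_zero_iff.mpr (Real.exp_pos _)  -- hmm
  have hcT : c ≠ ∞ := ENNReal.ofReal_ne_top
  calc μ A ≤ ENNReal.ofReal (Real.exp C) / c := by
        rw [ENNReal.le_div_iff_mul_le (Or.inl hc0) (Or.inl hcT), mul_comm]
        exact hmain
    _ = ENNReal.ofReal (Real.exp (C - lam₀ * (ω₂ * R ^ 2 / 2))) := by
        rw [hcdef, ← ENNReal.ofReal_div_of_pos (Real.exp_pos _), ← Real.exp_sub]

/-- **Superstable states of the pinned chain are one-site tight** (`ω₂ > 0`): for every `ε > 0`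
there is `R` with `μ {R < |q_x|} ≤ ε` for all sites `x`. [folklore] -/
theorem oneSiteTight_of_hasSuperstabilityEstimate {ω₂ lam β : ℝ} (γ : ℝ)
    (hω : 0 < ω₂) (hl : 0 ≤ lam) (hβ : 0 ≤ β) {μ : Measure ChainConfig}
    (hss : (pinnedChain ω₂ lam β γ).HasSuperstabilityEstimate μ) :
    ∀ ε : ℝ, 0 < ε → ∃ R : ℝ, ∀ x : ℤ,
      μ {σ : ChainConfig | R < |(σ x).1|} ≤ ENNReal.ofReal ε := by
  obtain ⟨C, lam₀, hlam₀, h⟩ :=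
    measure_abs_fst_gt_le_of_hasSuperstabilityEstimate γ hω.le hl hβ hss
  intro ε hε
  have hden : 0 < lam₀ * ω₂ := mul_pos hlam₀ hω
  set M : ℝ := max (C - Real.log ε) 0 with hMdef
  have hM0 : 0 ≤ M := le_max_right _ _
  set R : ℝ := Real.sqrt (2 * M / (lam₀ * ω₂)) with hRdef
  have hR0 : 0 ≤ R := Real.sqrt_nonneg _
  have hR2 : R ^ 2 = 2 * M / (lam₀ * ω₂) := by
    rw [hRdef, Real.sq_sqrt]; positivity
  refine ⟨R, fun x => (h R hR0 x).trans ?_⟩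
  apply ENNReal.ofReal_le_ofReal
  have hexp : C - lam₀ * (ω₂ * R ^ 2 / 2) = C - M := by
    rw [hR2]; field_simp
  rw [hexp]
  calc Real.exp (C - M) ≤ Real.exp (Real.log ε) := by
        apply Real.exp_le_exp.mpr
        have : C - Real.log ε ≤ M := le_max_left _ _
        linarith
    _ = ε := Real.exp_log hε

/-! ## §2 The registered reduction -/

/-- **`stub_witnessRegularisationOfDynamicalTightness`** (registered on stmt-AtomisticToContinuum-12596).
For `P = pinnedChain ω₂ lam β γ` (all `> 0`) and `T > 0`: IF
(DT) every DLR state of `P` at `T` preserved by some `InfiniteChainDynamics` with absolutely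
convergent current correlations is one-site tight, and
(TU) any two one-site-tight DLR states of `P` at `T` coincide,
THEN the seam `stub_witnessRegularisation` holds at `T`: an arbitrary Abelian Green–Kubo witness
`(μT, D', κ)` has `μT =` the transfer-operator state (DLR, shift-invariant, BM-superstable; tree:
`exists_isChainGibbsMeasure_shiftInvariant_superstable_pinnedChain`, tight by §1), so
`(μT, D', κ)` is itself a witness with regular state. [folklore] -/
theorem stub_witnessRegularisationOfDynamicalTightness :
    ∀ ω₂ lam β γ : ℝ, 0 < ω₂ → 0 < lam → 0 < β → 0 < γ →
      ∀ T : ℝ, 0 < T →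
        (∀ (μ : MeasureTheory.Measure
                Literature.MathematicalPhysics.KineticTheory.HeatConduction.ChainConfig)
            (D : Literature.MathematicalPhysics.KineticTheory.HeatConduction.InfiniteChainDynamics
              (Literature.MathematicalPhysics.KineticTheory.HeatConduction.pinnedChain ω₂ lam β γ)),
            (Literature.MathematicalPhysics.KineticTheory.HeatConduction.pinnedChain
                ω₂ lam β γ).IsChainGibbsMeasure T μ → D.PreservesMeasure μ →
            (∀ t : ℝ, D.HasAbsConvergentCorrelation μ t) →
            ∀ ε : ℝ, 0 < ε → ∃ R : ℝ, ∀ x : ℤ,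
              μ {σ : Literature.MathematicalPhysics.KineticTheory.HeatConduction.ChainConfig |
                  R < |(σ x).1|} ≤ ENNReal.ofReal ε) →
        (∀ μ₁ μ₂ : MeasureTheory.Measure
                Literature.MathematicalPhysics.KineticTheory.HeatConduction.ChainConfig,
            (Literature.MathematicalPhysics.KineticTheory.HeatConduction.pinnedChain
                ω₂ lam β γ).IsChainGibbsMeasure T μ₁ →
            (∀ ε : ℝ, 0 < ε → ∃ R : ℝ, ∀ x : ℤ,
              μ₁ {σ : Literature.MathematicalPhysics.KineticTheory.HeatConduction.ChainConfig |
                  R < |(σ x).1|} ≤ ENNReal.ofReal ε) →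
            (Literature.MathematicalPhysics.KineticTheory.HeatConduction.pinnedChain
                ω₂ lam β γ).IsChainGibbsMeasure T μ₂ →
            (∀ ε : ℝ, 0 < ε → ∃ R : ℝ, ∀ x : ℤ,
              μ₂ {σ : Literature.MathematicalPhysics.KineticTheory.HeatConduction.ChainConfig |
                  R < |(σ x).1|} ≤ ENNReal.ofReal ε) →
            μ₁ = μ₂) →
        (∃ (μT : MeasureTheory.Measure
                Literature.MathematicalPhysics.KineticTheory.HeatConduction.ChainConfig)
            (D' : Literature.MathematicalPhysics.KineticTheory.HeatConduction.InfiniteChainDynamics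
              (Literature.MathematicalPhysics.KineticTheory.HeatConduction.pinnedChain ω₂ lam β γ))
            (κ : ℝ),
            (Literature.MathematicalPhysics.KineticTheory.HeatConduction.pinnedChain
                ω₂ lam β γ).IsChainGibbsMeasure T μT ∧ D'.PreservesMeasure μT ∧
            (∀ t : ℝ, D'.HasAbsConvergentCorrelation μT t) ∧ 0 < κ ∧
            Filter.Tendsto (fun ν : ℝ => (T ^ 2)⁻¹ *
              MeasureTheory.integral (MeasureTheory.volume.restrict (Set.Ioi (0:ℝ)))
                (fun t : ℝ => Real.exp (-(ν * t)) * D'.currentCorrelation μT t))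
              (nhdsWithin (0:ℝ) (Set.Ioi 0)) (nhds κ)) →
        ∃ (μT : MeasureTheory.Measure
                Literature.MathematicalPhysics.KineticTheory.HeatConduction.ChainConfig)
            (D' : Literature.MathematicalPhysics.KineticTheory.HeatConduction.InfiniteChainDynamics
              (Literature.MathematicalPhysics.KineticTheory.HeatConduction.pinnedChain ω₂ lam β γ))
            (κ : ℝ),
            (Literature.MathematicalPhysics.KineticTheory.HeatConduction.pinnedChain
                ω₂ lam β γ).IsChainGibbsMeasure T μT ∧
            Literature.MathematicalPhysics.KineticTheory.HeatConduction.IsShiftInvariant μT ∧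
            (Literature.MathematicalPhysics.KineticTheory.HeatConduction.pinnedChain
                ω₂ lam β γ).HasSuperstabilityEstimate μT ∧
            D'.PreservesMeasure μT ∧
            (∀ t : ℝ, D'.HasAbsConvergentCorrelation μT t) ∧ 0 < κ ∧
            Filter.Tendsto (fun ν : ℝ => (T ^ 2)⁻¹ *
              MeasureTheory.integral (MeasureTheory.volume.restrict (Set.Ioi (0:ℝ)))
                (fun t : ℝ => Real.exp (-(ν * t)) * D'.currentCorrelation μT t))
              (nhdsWithin (0:ℝ) (Set.Ioi 0)) (nhds κ) := by
  intro ω₂ lam β γ hω hl hβ _hγ T hT hDT hTU hwit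
  obtain ⟨μT, D', κ, hG, hP, hAC, hκ, hlim⟩ := hwit
  obtain ⟨μr, hGr, hSr, hssr⟩ :=
    OscillatorChain.exists_isChainGibbsMeasure_shiftInvariant_superstable_pinnedChain
      γ hω hl.le hβ.le hT
  have htT := hDT μT D' hG hP hAC
  have htr := oneSiteTight_of_hasSuperstabilityEstimate γ hω hl.le hβ.le hssr
  have heq : μT = μr := hTU μT μr hG htT hGr htr
  refine ⟨μT, D', κ, hG, ?_, ?_, hP, hAC, hκ, hlim⟩
  · rw [heq]; exact hSr
  · rw [heq]; exact hssr

end Summit.AtomisticToContinuum.FouriersLaw.Theorems.AbelThermodynamicLimit.LoomisCompactHorizonWitness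

end
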